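import Mathlib
import Summits.PneNP.PneNP.Theorems.ConvexRankGatesConvexGateBlindRankPlusOne
import Summits.PneNP.PneNP.Theorems.ConvexRankGatesConvexGateBlindNegCoverHard
import Summits.PneNP.PneNP.Theorems.ConvexRankGatesConvexGateBlindColumnSpaceFifth

/-!
# PneNP / ConvexRankGates — `ConvexGateBlind`: rank + 1 and no negative covers for every `δ < 1/5`

Helpers (`--supports stmt-PneNP-10680`), COLUMN-SPACE line (prover seat 2, session 16): the two corollaries of the
column-space theorem, upgraded from `δ < 1/11` (session 13: `…RankPlusOne`, `…NegCoverHard`) to `δ < 1/5` via the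
second-generation catch bound `…CatchTwo.card_badColourings_le_two`.

* `lpSlice_terms_gt_choose_two_fifth` (stub `lpSlice_rank_plus_one_fifth`) — for every `δ ∈ (0,1/5)`: eventually in `m`,
  for every `ε > 0`, EVERY non-negative factorisation `cdist Q u − ε = ∑_{l<R} U_l(u) V_l(Q)` of the LP slice has
  `R ≥ C(m,2) + 1 = rank + 1` terms; `not_coneFactorisable_le_choose_two_fifth` is the `ConeFactorisable` phrasing.
* `negCoverHard_fifth` (stub `negCover_hard_fifth`) — for every `δ ∈ (0,1/5)` and every `c`: eventually no family of
  `s ≤ m^c` clique-non-negative weightings is a negative cover.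
[new]
-/

set_option linter.dupNamespace false

namespace Summit.PneNP.PneNP.Theorems

open Finset Real Filter Literature.Computability.Complexity
open Summit.PneNP.PneNP.Cruxes.ConvexGateBlind.StrictRankConicCover (Edge cdist)

noncomputable section

/-! ## Rank + 1 -/

/-- **ε-sensitivity costs at least one term, every `δ < 1/5`.** For every `δ ∈ (0, 1/5)`, eventually in `m` (`k = ⌈m^δ⌉₊`),
for every `ε > 0` and every `R ≤ C(m,2)`: there is NO non-negative factorisation `cdist Q u − ε = ∑_{l<R} U_l(u) V_l(Q)`
(`U ≥ 0`, `V_l ≥ 0` on `k`-sets) valid for all `k`-sets `Q` and all `k`-clique-free `u`. [new] -/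
theorem lpSlice_terms_gt_choose_two_fifth {δ : ℝ} (hδ0 : 0 < δ) (hδ1 : δ < 1 / 5) :
    ∀ᶠ m : ℕ in atTop, ∀ ε : ℝ, 0 < ε → ∀ R : ℕ, R ≤ m.choose 2 →
      ∀ (U : (Edge m → Bool) → Fin R → ℝ) (V : Fin R → Finset (Fin m) → ℝ),
      (∀ u l, 0 ≤ U u l) → (∀ l (Q : Finset (Fin m)), Q.card = ⌈(m : ℝ) ^ δ⌉₊ → 0 ≤ V l Q) →
      ¬ ∀ (Q : Finset (Fin m)) (u : Edge m → Bool), Q.card = ⌈(m : ℝ) ^ δ⌉₊ → cliqueFn m ⌈(m : ℝ) ^ δ⌉₊ u = false →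
          cdist Q u - ε = ∑ l, U u l * V l Q := by
  filter_upwards [columnSpace_cliqueDistConeRankHard_fifth hδ0 hδ1 2, eventually_catch_exponent_two hδ0 hδ1 0]
    with m hcol hk
  obtain ⟨hk4, hkm, -⟩ := hk
  intro ε hε R hR U V hU hV hall
  have hkm2 : ⌈(m : ℝ) ^ δ⌉₊ + 2 ≤ m := by omega
  choose t ht using fun l => exists_edgeWeighting_of_card_le (by omega) hkm2 ε U V hall hR l
  refine hcol ε hε R (hR.trans (Nat.choose_le_pow m 2)) t U (fun l Q hQ => ?_) hU (fun Q u hQ hu => ?_)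
  · rw [← ht l Q hQ]; exact hV l Q hQ
  · rw [hall Q u hQ hu]
    exact Finset.sum_congr rfl fun l _ => by rw [ht l Q hQ]

/-- **The same in the `ConeFactorisable` vocabulary of the strict-rank line** (`q = 0` PSD part, constant potential
`a ≡ ε`, `b ≡ 1`): for `δ ∈ (0,1/5)`, eventually in `m`, for every `ε > 0` and every `r ≤ C(m,2)`,
`¬ ConeFactorisable m ⌈m^δ⌉₊ 0 r (fun _ => ε) (fun _ => 1)`. [new] -/
theorem not_coneFactorisable_le_choose_two_fifth {δ : ℝ} (hδ0 : 0 < δ) (hδ1 : δ < 1 / 5) :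
    ∀ᶠ m : ℕ in atTop, ∀ ε : ℝ, 0 < ε → ∀ r : ℕ, r ≤ m.choose 2 →
      ¬ Summit.PneNP.PneNP.Cruxes.ConvexGateBlind.StrictRankConicCover.ConeFactorisable m ⌈(m : ℝ) ^ δ⌉₊ 0 r
        (fun _ => ε) (fun _ => 1) := by
  filter_upwards [lpSlice_terms_gt_choose_two_fifth hδ0 hδ1] with m hm
  intro ε hε r hr hcf
  obtain ⟨H, Y, U, V, -, -, hU, hV, hall⟩ := hcf
  refine hm ε hε r hr U V hU (fun l Q _ => hV l Q) fun Q u hQ hu => ?_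
  have h := hall Q u hQ hu
  rw [Matrix.trace, Fintype.sum_empty, zero_add, mul_one] at h
  exact h

/-- **ε-sensitivity costs at least one term, every `δ < 1/5`** (registered form of `lpSlice_terms_gt_choose_two_fifth`).
[new] -/
theorem lpSlice_rank_plus_one_fifth : ∀ (δ : ℝ), 0 < δ → δ < 1 / 5 → ∀ᶠ m : ℕ in Filter.atTop, ∀ ε : ℝ, 0 < ε → ∀ R : ℕ, R ≤ m.choose 2 → ∀ (U : (Edge m → Bool) → Fin R → ℝ) (V : Fin R → Finset (Fin m) → ℝ), (∀ u l, 0 ≤ U u l) → (∀ l (Q : Finset (Fin m)), Q.card = ⌈(m : ℝ) ^ δ⌉₊ → 0 ≤ V l Q) → ¬ ∀ (Q : Finset (Fin m)) (u : Edge m → Bool), Q.card = ⌈(m : ℝ) ^ δ⌉₊ → cliqueFn m ⌈(m : ℝ) ^ δ⌉₊ u = false → cdist Q u - ε = ∑ l, U u l * V l Q :=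
  fun _ hδ0 hδ1 => lpSlice_terms_gt_choose_two_fifth hδ0 hδ1

/-! ## No polynomial negative covers -/

/-- **Negative covers are large, abstract catch bound (fixed `m`).** For `3 ≤ k`, `k + 2 ≤ m`, `k`-clique-non-negative
`t_1,…,t_s`, `μ ≥ 0` with `∑_j μ_j(u) t_j ≤ −1` on the edges of every `k`-clique-free `u`, and a catch bound `θ`:
`(k−1)^m − (k−1) ≤ s·((k−1)^m·θ)`. [new] -/
theorem negCover_size_lower_bound_of_catch {m k s : ℕ} (hk : 3 ≤ k) (hm : k + 2 ≤ m)
    (t : Fin s → Edge m → ℝ) (ht : ∀ j (Q : Finset (Fin m)), Q.card = k → 0 ≤ ∑ e, if cliqueVec Q e = true then t j e else 0)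
    (μ : (Edge m → Bool) → Fin s → ℝ) (hμ : ∀ u j, 0 ≤ μ u j)
    (hcov : ∀ u, cliqueFn m k u = false → ∀ e, u e = true → ∑ j, μ u j * t j e ≤ -1)
    (θ : ℝ) (hcatch : ∀ w : Edge m → ℝ, (∀ Q ∈ (Finset.univ : Finset (Fin m)).powersetCard k, 0 ≤ softWindow w Q) →
      ((((Finset.univ : Finset (Fin m → Fin (k - 1))).filter fun c =>
        ∑ e, (if colorVec c e = true then w e else 0) < 0).card : ℝ)) ≤ ((k - 1 : ℕ) : ℝ) ^ m * θ) :
    ((k - 1 : ℕ) : ℝ) ^ m - ((k - 1 : ℕ) : ℝ) ≤ s * (((k - 1 : ℕ) : ℝ) ^ m * θ) := by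
  classical
  set BAD : Fin s → Finset (Fin m → Fin (k - 1)) := fun j =>
    (Finset.univ : Finset (Fin m → Fin (k - 1))).filter fun c => ∑ e, (if colorVec c e = true then t j e else 0) < 0
    with hBAD
  have hcover : ((Finset.univ : Finset (Fin m → Fin (k - 1))).filter fun c => ∃ x y, c x ≠ c y) ⊆
      (Finset.univ : Finset (Fin s)).biUnion BAD := by
    intro c hc
    rw [Finset.mem_filter] at hc
    have hcf : cliqueFn m k (colorVec c) = false := cliqueFn_colorVec c (by omega)
    obtain ⟨j, hj⟩ := exists_neg_sum_of_negCover t (μ (colorVec c)) (hμ (colorVec c)) (colorVec c)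
      (exists_colorVec_eq_true c hc.2) (hcov (colorVec c) hcf)
    exact Finset.mem_biUnion.2 ⟨j, Finset.mem_univ _, Finset.mem_filter.2 ⟨Finset.mem_univ _, hj⟩⟩
  have hcatch' : ∀ j : Fin s, ((BAD j).card : ℝ) ≤ ((k - 1 : ℕ) : ℝ) ^ m * θ := by
    intro j
    refine hcatch (t j) fun Q hQ => ?_
    rw [← sum_ite_cliqueVec_eq_softWindow]
    exact ht j Q (Finset.mem_powersetCard.1 hQ).2
  have hnc := card_filter_nonconstant_ge (K := k - 1) (show 0 < m by omega)
  have h1 : (((Finset.univ : Finset (Fin m → Fin (k - 1))).filter fun c => ∃ x y, c x ≠ c y).card : ℝ) ≤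
      ∑ j : Fin s, ((BAD j).card : ℝ) := by
    have := (Finset.card_le_card hcover).trans Finset.card_biUnion_le
    exact_mod_cast this
  have h2 : ∑ j : Fin s, ((BAD j).card : ℝ) ≤ s * (((k - 1 : ℕ) : ℝ) ^ m * θ) := by
    calc ∑ j : Fin s, ((BAD j).card : ℝ) ≤ ∑ _j : Fin s, ((k - 1 : ℕ) : ℝ) ^ m * θ := Finset.sum_le_sum fun j _ => hcatch' j
      _ = _ := by rw [Finset.sum_const, Finset.card_univ, Fintype.card_fin, nsmul_eq_mul]
  have h0 : (((k - 1 : ℕ) : ℝ)) ^ m ≤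
      (((Finset.univ : Finset (Fin m → Fin (k - 1))).filter fun c => ∃ x y, c x ≠ c y).card : ℝ) + ((k - 1 : ℕ) : ℝ) := by
    exact_mod_cast hnc
  linarith

/-- **No polynomial negative covers (every `δ ∈ (0, 1/5)`, every `c`).** Eventually in `m` (`k = ⌈m^δ⌉₊`), for every
`s ≤ m^c`, all `k`-clique-non-negative `t_1,…,t_s` and all `μ ≥ 0`: the family is NOT a negative cover. (Hypotheses `0 ≤ Λ`,
`∑_j μ_j t_j ≤ Λ` kept for comparability with `negCoverHard_of_convexGateBlind`, not used.) [new] -/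
theorem negCoverHard_fifth {δ : ℝ} (hδ0 : 0 < δ) (hδ1 : δ < 1 / 5) :
    ∀ c : ℕ, ∀ᶠ m : ℕ in atTop, ∀ s : ℕ, s ≤ m ^ c →
      ∀ (t : Fin s → Edge m → ℝ) (μ : (Edge m → Bool) → Fin s → ℝ) (Λ : ℝ),
        (∀ j (Q : Finset (Fin m)), Q.card = ⌈(m : ℝ) ^ δ⌉₊ → 0 ≤ ∑ e, if cliqueVec Q e = true then t j e else 0) →
        (∀ u j, 0 ≤ μ u j) → 0 ≤ Λ →
        (∀ u, cliqueFn m ⌈(m : ℝ) ^ δ⌉₊ u = false → ∀ e, ∑ j, μ u j * t j e ≤ Λ) →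
        ¬ ∀ u, cliqueFn m ⌈(m : ℝ) ^ δ⌉₊ u = false → ∀ e, u e = true → ∑ j, μ u j * t j e ≤ -1 := by
  intro c
  filter_upwards [eventually_catch_exponent_two hδ0 hδ1 c] with m hm
  obtain ⟨hk4, hkm, hsmall⟩ := hm
  intro s hs t μ Λ ht hμ _ _ hcov
  set k : ℕ := ⌈(m : ℝ) ^ δ⌉₊ with hk
  have hkm2 : k + 2 ≤ m := by omega
  set θ : ℝ := Real.exp (-(((m : ℝ) - 1) / (9216 * k * (2 * (k : ℝ) ^ 2 - 4 * k + 1) ^ 2))) +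
    Real.exp (-(1 / (5200 * Real.sqrt (((k : ℝ) * (k - 1) / 2) * ((k - 2) / (m - k)))))) with hθ
  have hlb := negCover_size_lower_bound_of_catch (by omega) hkm2 t ht μ hμ hcov θ
    (fun w hw => by
      have h := card_badColourings_le_two hk4 hkm2 w hw
      rw [hθ, mul_add]
      exact h)
  have hθ0 : 0 < θ := by rw [hθ]; positivity
  have hq3 : (3 : ℝ) ≤ ((k - 1 : ℕ) : ℝ) := by
    have : 3 ≤ k - 1 := by omega
    exact_mod_cast this
  set qm : ℝ := ((k - 1 : ℕ) : ℝ) ^ m with hqm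
  have hqm0 : 0 < qm := by rw [hqm]; positivity
  have hq_le : ((k - 1 : ℕ) : ℝ) ≤ qm / 2 := by
    obtain ⟨m', hm'⟩ : ∃ m', m = m' + 2 := ⟨m - 2, by omega⟩
    rw [hqm, hm', pow_succ, pow_succ]
    have h1 : (1 : ℝ) ≤ ((k - 1 : ℕ) : ℝ) ^ m' := one_le_pow₀ (by linarith)
    have hQ0 : (0 : ℝ) ≤ ((k - 1 : ℕ) : ℝ) := by positivity
    have h2 := mul_le_mul h1 hq3 (by norm_num) (by positivity)
    have h3 := mul_le_mul_of_nonneg_right h2 hQ0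
    linarith
  have hsθ : (s : ℝ) * (qm * θ) ≤ qm / 4 := by
    have hs' : (s : ℝ) ≤ (m : ℝ) ^ c := by exact_mod_cast hs
    calc (s : ℝ) * (qm * θ) ≤ (m : ℝ) ^ c * (qm * θ) := mul_le_mul_of_nonneg_right hs' (by positivity)
      _ = qm * ((m : ℝ) ^ c * θ) := by ring
      _ ≤ qm * (1 / 4) := mul_le_mul_of_nonneg_left hsmall hqm0.le
      _ = qm / 4 := by ring
  linarith

/-- **No polynomial negative covers, every `δ < 1/5`** (registered form of `negCoverHard_fifth`). [new] -/
theorem negCover_hard_fifth : ∀ (δ : ℝ), 0 < δ → δ < 1 / 5 → ∀ c : ℕ, ∀ᶠ m : ℕ in Filter.atTop, ∀ s : ℕ, s ≤ m ^ c → ∀ (t : Fin s → Edge m → ℝ) (μ : (Edge m → Bool) → Fin s → ℝ) (Λ : ℝ), (∀ j (Q : Finset (Fin m)), Q.card = ⌈(m : ℝ) ^ δ⌉₊ → 0 ≤ ∑ e, if cliqueVec Q e = true then t j e else 0) → (∀ u j, 0 ≤ μ u j) → 0 ≤ Λ → (∀ u, cliqueFn m ⌈(m : ℝ) ^ δ⌉₊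 u = false → ∀ e, ∑ j, μ u j * t j e ≤ Λ) → ¬ ∀ u, cliqueFn m ⌈(m : ℝ) ^ δ⌉₊ u = false → ∀ e, u e = true → ∑ j, μ u j * t j e ≤ -1 :=
  fun _ hδ0 hδ1 c => negCoverHard_fifth hδ0 hδ1 c

end

end Summit.PneNP.PneNP.Theorems
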